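import Summits.ResolutionOfSingularities.ResolutionOfSingularities.Theorems.WeightedInvariantIota3CriticalInFormTools
import Summits.ResolutionOfSingularities.ResolutionOfSingularities.Theorems.WeightedInvariantKeyRungThreeOfResidueAllRings
import HarnessLib

/-!
# THE RESIDUE hres₃ MODULO ONE LEMMA OF PURE ALGEBRA (LEMMA C), and the gap list of `stub_keyRungGrHomLE_three` with it
# (door `HypersurfaceCentreConstruction`, stmt-ResolutionOfSingularities-19897)

Helper for `stub_keyRungGrHomLE_three` (def-free, `--supports 19897`).  Assembly of the bricks …Iota3RatioMaxNonSolvable (LEMMA B),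
…Iota3CriticalTriple, …Iota3CriticalReduction, …Iota3CriticalNonSolvable with the initial-form calculus of the Literature
(`Literature…WeightedInitialForms`: `IsInForm`, `inForm`, uniqueness by weighted quasi-regularity) in the critical graded ring
`gr_{F₃} A = κ[X₀, X₁, X₂]` (`F₃ = F_{(g₁,g₂; r₂, j r₁, j r₂)}`, `κ` the residue field, `X₀ ↔ x`, `X₁ ↔ g₂`, `X₂ ↔ g₁`):

* `Iota3.secondMember_mem_of_lemmaC` — **SECOND-MEMBER DOMINANCE `g₂' ∈ F_{(g₁,g₂)}(r₂)` at `q < r₂ < r₁`** (every regular local ring of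
  dimension three, every `0 ≠ f ∈ 𝔪`, ratio bound of the dominance word; NO tangent-form hypothesis) **from LEMMA C** over the residue field:
  if `g₂' ∉ F(r₂)`, its level is `qj < r₂`; at the critical triple both flags read `f`, (E1) compares them, and the critical initial form
  `Φ = in₃(f)` is at once a PURE polynomial `Σ ū_e X₁^{e₁} X₂^{e₂}` (flag `(g₁,g₂)`) and `Σ ū'_e η^{e₁} ζ^{e₂}` (flag `(g₁',g₂')`, `η = in₃(g₂')`
  with a non-zero `X₀^j` term, `ζ = in₃(g₁')`), with `Y^ν = X₂^ν ∈ supp Φ`; LEMMA C then says `Φ = ū (X₂ − ā X₁^ρ)^ν`, which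
  `Iota3.critical_nonSolvable` (LEMMA B + quasi-regularity) forbids.
* `keyRungGrHomLE_three_of_lemmaC` — **GAP LIST OF RECORD for `stub_keyRungGrHomLE_three`**: hD (desc-τ as typed; door-proved), hgame, and
  **LEMMA C** (a statement about polynomials in three variables over a field; no local rings):
  «`Φ ∈ κ[X₁,X₂]` pure of weight `r₁ν` (monomials `X₁^{e₁}X₂^{e₂}`, `r₁e₂ + r₂e₁ = r₁ν`) with `X₂^ν ∈ supp Φ`; `η`, `ζ` weighted homogeneous of
  degrees `j r₂`, `j r₁` for the weights `(r₂, j r₂, j r₁)` (`0 < r₂ < r₁`, `1 ≤ j`, `1 ≤ ν`), `X₀^j ∈ supp η`; `Φ = Σ_{e pure} θ_e η^{e₁} ζ^{e₂}`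
  ⇒ `Φ = u (X₂ − a X₁^{r₁/r₂})^ν` with `a ≠ 0` only if `r₂ ∣ r₁`».  Proof route (memo RESIDUE-PLAN.md): `η = ēX₀^j + β̄X₁`, `ζ = λ̄X₂ + θ(X₀,X₁)`
  by weight count; `β̄ = 0` ⇒ put `X₀ = 0`; `β̄ ≠ 0` ⇒ `Φ` is fixed by `X₁ ↦ X₁ + εX₀^j`, `X₂ ↦ X₂ + τ(X₀,X₁)`, then Hasse derivatives in `X₂`
  (char `0` / `p ∤ ν`: Tschirnhaus; `ν = p^e ν₁`: `D^{(p^e)}` and induction; `ν = p^e`: Frobenius on `τ^{p^e} = λ(X₁^{b} − (X₁+εX₀^j)^{b})`).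

[OURS · L1 W4.3 · (o70-b)/(Δ12) · audit glue; AI work, weaker than expert review; nothing here is a statement of the manuscript under review.]
-/

noncomputable section

open IsLocalRing Literature.AlgebraicGeometry.Resolution MvPolynomial
open Summit.ResolutionOfSingularities.ResolutionOfSingularities.Theorems

set_option linter.dupNamespace false -- mandated namespace of this single-conjunct summit

namespace Summit.ResolutionOfSingularities.ResolutionOfSingularities.Cruxes.HypersurfaceCentreConstruction.LocalEngine

namespace Iota3

/-! ## §3 The residue from LEMMA C -/

section Main

variable {A : Type} [CommRing A] [IsRegularLocalRing A]

/-- **SECOND-MEMBER DOMINANCE AT `q < r₂ < r₁` FROM LEMMA C.**  `A` regular local of dimension three, `0 ≠ f ∈ 𝔪`, `ν = ord f`; under the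
ratio bound `a/b` of the dominance word (`0 < b`), for two two-flags `(g₁,g₂)`, `(g₁',g₂')` carrying `f` to level `r₁ν` of a common
admissible `(q; r₁, r₂)` with `r₁ b = a r₂`, `q < r₂ < r₁`: **`g₂' ∈ F_{(g₁,g₂)}(r₂)`** — PROVIDED LEMMA C holds over the residue field
(hypothesis `hC`, pure algebra in `κ[X₀,X₁,X₂]`).  No tangent-form hypothesis. [OURS · L1 W4.3 · (o70-b)/(Δ12)] -/
theorem secondMember_mem_of_lemmaC (hdim : ringKrullDim A = (3 : ℕ)) {f : A} (hf0 : f ≠ 0) (hfm : f ∈ maximalIdeal A)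
    (hC : ∀ (r₁ r₂ j ν : ℕ), 0 < r₂ → r₂ < r₁ → 1 ≤ j → 1 ≤ ν →
      ∀ (Φ η ζ : MvPolynomial (Fin 3) (ResidueField A)) (s : Finset (Fin 3 →₀ ℕ)) (θ : (Fin 3 →₀ ℕ) → ResidueField A),
      (∀ e ∈ Φ.support, e 0 = 0 ∧ r₁ * e 2 + r₂ * e 1 = r₁ * ν) →
      Φ.coeff (Finsupp.single 2 ν) ≠ 0 →
      η.IsWeightedHomogeneous ![r₂, j * r₂, j * r₁] (j * r₂) → η.coeff (Finsupp.single 0 j) ≠ 0 →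
      ζ.IsWeightedHomogeneous ![r₂, j * r₂, j * r₁] (j * r₁) →
      (∀ e ∈ s, e 0 = 0 ∧ r₁ * e 2 + r₂ * e 1 = r₁ * ν) →
      Φ = ∑ e ∈ s, C (θ e) * (η ^ (e 1) * ζ ^ (e 2)) →
      ∃ u a : ResidueField A, Φ = C u * (X 2 - C a * X 1 ^ (r₁ / r₂)) ^ ν ∧ (a ≠ 0 → r₂ ∣ r₁))
    {a b : ℕ} (hb : 0 < b)
    (hbound : ∀ q' r₁' r₂' : ℕ, AdmissibleTriple q' r₁' r₂' → FlagReaches f (adicOrder f).toNat q' r₁' r₂' → r₁' * b ≤ a * r₂')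
    {g₁ g₂ g₁' g₂' : A} {q r₁ r₂ : ℕ} (hadm : AdmissibleTriple q r₁ r₂) (hab : r₁ * b = a * r₂) (hq₂ : q < r₂) (hr : r₂ < r₁)
    (hΦ : IsTwoFlag g₁ g₂) (hΦ' : IsTwoFlag g₁' g₂')
    (hF : f ∈ flagContactFiltration g₁ g₂ q r₁ r₂ (r₁ * (adicOrder f).toNat))
    (hF' : f ∈ flagContactFiltration g₁' g₂' q r₁ r₂ (r₁ * (adicOrder f).toNat)) :
    g₂' ∈ flagContactFiltration g₁ g₂ q r₁ r₂ r₂ := by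
  classical
  by_contra hnot
  obtain ⟨hν, -, hford⟩ := EssSmoothLevels.adicOrder_toNat_spec hf0 hfm
  set ν := (adicOrder f).toNat with hνdef
  have hq : 0 < q := hadm.1
  have hr₂ : 0 < r₂ := lt_trans hq hq₂
  have hdim3 : ringKrullDim A = 3 := by rw [hdim]; rfl
  obtain ⟨x, h𝔪, -⟩ := exists_span_triple_of_isTwoFlag A hdim g₁ g₂ hΦ
  -- the level `qj` of `g₂'`
  obtain ⟨j, hj, hqj, hlev, hnlev⟩ := exists_level_of_not_mem hq hadm.2.1 hr.le hΦ'.2.1 hnot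
  -- the critical triple: comparable filtrations
  obtain ⟨h₂₃, h₁₃, hle⟩ := critical_comparison hdim3 h𝔪 hq hj hqj hr hν hford hF hΦ'.1 hΦ'.2.1 hF' hlev
  -- pure parts for both flags
  obtain ⟨π, h, hsum, hπP, hhE, hh₃⟩ := exists_pure_add hq hj hqj hF
  obtain ⟨π', h', hsum', hπ'P, -, hh'₃⟩ := exists_pure_add hq hj hqj hF'
  have hh'₃F : h' ∈ flagContactFiltration g₁ g₂ r₂ (j * r₁) (j * r₂) (j * r₁ * ν + 1) := hle _ hh'₃
  -- the critical graded ring of `(x, g₂, g₁; r₂, j r₂, j r₁)`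
  have hq₂₃ : r₂ ≤ j * r₂ := Nat.le_mul_of_pos_left r₂ hj
  have hq₁₃ : r₂ ≤ j * r₁ := hr.le.trans (Nat.le_mul_of_pos_left r₁ hj)
  have hgen : Ideal.span {(![x, g₂, g₁] : Fin 3 → A) 0, (![x, g₂, g₁] : Fin 3 → A) 1, (![x, g₂, g₁] : Fin 3 → A) 2} =
      maximalIdeal A := by
    simpa using h𝔪
  have hgenr : Ideal.span (Set.range (![x, g₂, g₁] : Fin 3 → A)) = maximalIdeal A := span_range_eq_of_span_triple _ hgen
  have hw : ∀ i, 0 < (![r₂, j * r₂, j * r₁] : Fin 3 → ℕ) i := by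
    intro i; fin_cases i
    · exact hr₂
    · exact lt_of_lt_of_le hr₂ hq₂₃
    · exact lt_of_lt_of_le hr₂ hq₁₃
  have hbridge : ∀ n, flagContactFiltration g₁ g₂ r₂ (j * r₁) (j * r₂) n = weightedIdealW ![x, g₂, g₁] ![r₂, j * r₂, j * r₁] n :=
    fun n => by
    rw [flagContactFiltration_eq_weightedMonomialIdeal h𝔪 hr₂ hq₂₃ hq₁₃ n, CrossingPoint.weightedMonomialIdeal_eq_weightedIdealW]
  have hwt : ∀ e : Fin 3 →₀ ℕ, Finsupp.weight (![r₂, j * r₂, j * r₁] : Fin 3 → ℕ) e = r₂ * e 0 + j * r₂ * e 1 + j * r₁ * e 2 :=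
    fun e => by
    rw [Finsupp.weight_apply, Finsupp.sum_fintype _ _ (by simp)]
    simp [smul_eq_mul, mul_comm, Fin.sum_univ_three]
  have hpurewt : ∀ e : Fin 3 →₀ ℕ, e 0 = 0 → r₁ * e 2 + r₂ * e 1 = r₁ * ν →
      Finsupp.weight (![r₂, j * r₂, j * r₁] : Fin 3 → ℕ) e = j * r₁ * ν := by
    intro e h0 hp
    rw [hwt, h0, mul_zero, zero_add]
    have : j * (r₁ * e 2 + r₂ * e 1) = j * (r₁ * ν) := by rw [hp]
    linarith
  -- pure polynomial representatives
  obtain ⟨G, hG, hGπ⟩ := exists_poly_of_mem_pure (x := x) hπP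
  obtain ⟨G', hG', hG'π⟩ := exists_poly_of_mem_pure (x := x) hπ'P
  have hGhom : G.IsWeightedHomogeneous (![r₂, j * r₂, j * r₁] : Fin 3 → ℕ) (j * r₁ * ν) := by
    intro d hd
    obtain ⟨h0, hp⟩ := hG d (mem_support_iff.mpr hd)
    exact hpurewt d h0 hp
  -- `Φ = in₃(π) = in₃(f)`
  set Φ := MvPolynomial.map (residue A) G with hΦdef
  have hπin : IsInForm ![x, g₂, g₁] ![r₂, j * r₂, j * r₁] (j * r₁ * ν) π Φ :=
    ⟨G, hGhom, rfl, by rw [hGπ, sub_self]; exact zero_mem _⟩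
  have hfin : IsInForm ![x, g₂, g₁] ![r₂, j * r₂, j * r₁] (j * r₁ * ν) f Φ := by
    have h1 := hπin.add _ (isInForm_zero_of_mem_succ ![x, g₂, g₁] (by rw [← hbridge]; exact hh₃))
    rwa [add_zero, ← hsum] at h1
  -- `η = in₃(g₂')`, `ζ = in₃(g₁')`
  have hη := isInForm_inForm ![x, g₂, g₁] hgen hdim3 hw (by rw [← hbridge]; exact h₂₃)
  have hζ := isInForm_inForm ![x, g₂, g₁] hgen hdim3 hw (by rw [← hbridge]; exact h₁₃)
  set η := inForm ![x, g₂, g₁] ![r₂, j * r₂, j * r₁] (j * r₂) g₂' with hηdef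
  set ζ := inForm ![x, g₂, g₁] ![r₂, j * r₂, j * r₁] (j * r₁) g₁' with hζdef
  -- `Φ = in₃(π') = Σ θ_e η^{e₁} ζ^{e₂}` by uniqueness of initial forms
  have hf'in : IsInForm ![x, g₂, g₁] ![r₂, j * r₂, j * r₁] (j * r₁ * ν) f
      (∑ e ∈ G'.support, C (residue A (G'.coeff e)) * (η ^ (e 1) * ζ ^ (e 2))) := by
    have hexp : π' = ∑ e ∈ G'.support, G'.coeff e * (g₂' ^ (e 1) * g₁' ^ (e 2)) := by
      rw [← hG'π, eval_eq']
      refine Finset.sum_congr rfl fun e he => ?_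
      rw [Fin.prod_univ_three]
      simp only [Matrix.cons_val_zero, Matrix.cons_val_one, Matrix.cons_val_two, Matrix.head_cons,
        Matrix.tail_cons, (hG' e he).1, pow_zero, one_mul]
    have hπ'in : IsInForm ![x, g₂, g₁] ![r₂, j * r₂, j * r₁] (j * r₁ * ν) π'
        (∑ e ∈ G'.support, C (residue A (G'.coeff e)) * (η ^ (e 1) * ζ ^ (e 2))) := by
      rw [hexp]
      refine isInForm_finset_sum _ _ fun e he => ?_
      have hprod := (isInForm_pow _ hη (e 1)).mul ![x, g₂, g₁] (isInForm_pow _ hζ (e 2))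
      have hdeg : e 1 * (j * r₂) + e 2 * (j * r₁) = j * r₁ * ν := by
        obtain ⟨-, hp⟩ := hG' e he
        have : j * (r₁ * e 2 + r₂ * e 1) = j * (r₁ * ν) := by rw [hp]
        linarith
      rw [hdeg] at hprod
      exact hprod.smul _ (G'.coeff e)
    have h1 := hπ'in.add _ (isInForm_zero_of_mem_succ ![x, g₂, g₁] (by rw [← hbridge]; exact hh'₃F))
    rwa [add_zero, ← hsum'] at h1
  have hΦeq : Φ = ∑ e ∈ G'.support, C (residue A (G'.coeff e)) * (η ^ (e 1) * ζ ^ (e 2)) :=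
    IsInForm.unique _ hgen hdim3 hw hfin hf'in
  -- hypotheses of LEMMA C
  have hΦpure : ∀ e ∈ Φ.support, e 0 = 0 ∧ r₁ * e 2 + r₂ * e 1 = r₁ * ν :=
    fun e he => hG e (support_map_subset _ _ he)
  have hηhom : η.IsWeightedHomogeneous (![r₂, j * r₂, j * r₁] : Fin 3 → ℕ) (j * r₂) :=
    isWeightedHomogeneous_inForm _ hgen hdim3 hw hη.mem
  have hζhom : ζ.IsWeightedHomogeneous (![r₂, j * r₂, j * r₁] : Fin 3 → ℕ) (j * r₁) :=
    isWeightedHomogeneous_inForm _ hgen hdim3 hw hζ.mem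
  have hη0 : η.coeff (Finsupp.single 0 j) ≠ 0 := by
    intro h0
    -- then `η = β̄ · X₁`, so `g₂' ≡ β g₂` one critical step deeper, i.e. `g₂' ∈ F(qj + 1)`
    have hηeq : η = C (η.coeff (Finsupp.single 1 1)) * X 1 := by
      ext d
      rw [coeff_C_mul, coeff_X]
      by_cases hd : η.coeff d = 0
      · rw [hd]
        split_ifs with h1
        · rw [mul_one, h1, hd]
        · rw [mul_zero]
      · have hwd := hηhom hd
        rw [hwt] at hwd
        rcases exponent_of_weight_critical₂ hr₂ hr hj hwd with h | h
        · exact absurd h0 (h ▸ hd)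
        · subst h; rw [if_pos rfl, mul_one]
    obtain ⟨β, hβ⟩ := IsLocalRing.residue_surjective (η.coeff (Finsupp.single 1 1))
    have hβin : IsInForm ![x, g₂, g₁] ![r₂, j * r₂, j * r₁] (j * r₂) (β * g₂) (C (η.coeff (Finsupp.single 1 1)) * X 1) := by
      have h1 := (isInForm_X ![x, g₂, g₁] ![r₂, j * r₂, j * r₁] 1).smul ![x, g₂, g₁] β
      rw [hβ] at h1
      simpa only [Matrix.cons_val_one, Matrix.cons_val_zero, Matrix.head_cons] using h1
    have hdiff : g₂' - β * g₂ ∈ flagContactFiltration g₁ g₂ q r₁ r₂ (q * j + 1) := by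
      have h1 := isInForm_sub _ hη hβin
      have hz : η - C (η.coeff (Finsupp.single 1 1)) * X 1 = 0 := sub_eq_zero.mpr hηeq
      rw [hz] at h1
      have h2 := mem_succ_of_isInForm_zero _ hgenr hw h1
      rw [← hbridge] at h2
      exact critical_succ_le hq (by omega) hr.le h2
    refine hnlev ?_
    have : g₂' = (g₂' - β * g₂) + β * g₂ := by ring
    rw [this]
    refine Ideal.add_mem _ hdiff (Ideal.mul_mem_left _ β ?_)
    exact flagContactFiltration_antitone g₁ g₂ q r₁ r₂ (by omega : q * j + 1 ≤ r₂)
      (self_mem_flagContactFiltration g₁ g₂ r₁ r₂ hq).2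
  have hΦν : Φ.coeff (Finsupp.single 2 ν) ≠ 0 := by
    intro h0
    rw [hΦdef, coeff_map, residue_eq_zero_iff] at h0
    apply hford
    rw [hsum, ← hGπ]
    refine Ideal.add_mem _ ?_ ?_
    · rw [eval_eq']
      refine Ideal.sum_mem _ fun e he => ?_
      obtain ⟨he0, hp⟩ := hG e he
      rw [Fin.prod_univ_three]
      simp only [Matrix.cons_val_zero, Matrix.cons_val_one, Matrix.cons_val_two, Matrix.head_cons,
        Matrix.tail_cons, he0, pow_zero, one_mul]
      by_cases heν : e = Finsupp.single 2 ν
      · subst heν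
        rw [Finsupp.single_eq_same, Finsupp.single_eq_of_ne (by decide), pow_zero, one_mul, pow_succ']
        exact Ideal.mul_mem_mul h0 (Ideal.pow_mem_pow hΦ.1 ν)
      · have hdeg := pure_degree_gt hr₂ hr he0 hp heν
        refine Ideal.mul_mem_left _ _ (Ideal.pow_le_pow_right hdeg ?_)
        rw [pow_add]
        exact Ideal.mul_mem_mul (Ideal.pow_mem_pow hΦ.2.1 _) (Ideal.pow_mem_pow hΦ.1 _)
    · exact flagContactFiltration_le_pow_of_lt₂ hΦ.1 hΦ.2.1 hr₂ hq₁₃ (Nat.mul_le_mul_left j hr.le) (by nlinarith) hh₃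
  -- LEMMA C
  obtain ⟨u, a', hΦua, ha'⟩ := hC r₁ r₂ j ν hr₂ hr hj hν Φ η ζ G'.support (fun e => residue A (G'.coeff e)) hΦpure hΦν
    hηhom hη0 hζhom hG' hΦeq
  obtain ⟨ut, hut⟩ := IsLocalRing.residue_surjective u
  by_cases ha0 : a' = 0
  · -- `Φ = ū Y^ν`: forbidden by `critical_nonSolvable_pow`
    rw [ha0, map_zero, zero_mul, sub_zero] at hΦua
    have hin : IsInForm ![x, g₂, g₁] ![r₂, j * r₂, j * r₁] (j * r₁ * ν) (ut * g₁ ^ ν) (C u * X 2 ^ ν) := by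
      have h1 := (isInForm_pow _ (isInForm_X ![x, g₂, g₁] ![r₂, j * r₂, j * r₁] 2) ν).smul ![x, g₂, g₁] ut
      rw [hut] at h1
      simp only [Matrix.cons_val_two, Matrix.tail_cons, Matrix.head_cons] at h1
      rwa [show ν * (j * r₁) = j * r₁ * ν by ring] at h1
    have hzero := isInForm_sub _ hπin hin
    rw [hΦua, sub_self] at hzero
    have hmem := mem_succ_of_isInForm_zero _ hgenr hw hzero
    rw [← hbridge] at hmem
    exact critical_nonSolvable_pow hdim3 h𝔪 hΦ hν hb hbound hadm hab hq₂ hj hqj hsum hπP hhE ut hmem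
  · -- `Φ = ū (Y − ā V^ρ)^ν` with `r₂ ∣ r₁`: forbidden by `critical_nonSolvable`
    obtain ⟨ρ, hρ⟩ := ha' ha0
    have hρ' : r₁ / r₂ = ρ := by rw [hρ, Nat.mul_div_cancel_left _ hr₂]
    rw [hρ'] at hΦua
    obtain ⟨at', hat⟩ := IsLocalRing.residue_surjective a'
    have hzin : IsInForm ![x, g₂, g₁] ![r₂, j * r₂, j * r₁] (j * r₁) (g₁ - at' * g₂ ^ ρ) (X 2 - C a' * X 1 ^ ρ) := by
      have h2 := isInForm_X ![x, g₂, g₁] ![r₂, j * r₂, j * r₁] 2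
      simp only [Matrix.cons_val_two, Matrix.tail_cons, Matrix.head_cons] at h2
      have h1 := (isInForm_pow _ (isInForm_X ![x, g₂, g₁] ![r₂, j * r₂, j * r₁] 1) ρ).smul ![x, g₂, g₁] at'
      rw [hat] at h1
      simp only [Matrix.cons_val_one, Matrix.cons_val_zero] at h1
      rw [show ρ * (j * r₂) = j * r₁ by rw [hρ]; ring] at h1
      exact isInForm_sub _ h2 h1
    have hin : IsInForm ![x, g₂, g₁] ![r₂, j * r₂, j * r₁] (j * r₁ * ν) (ut * (g₁ - at' * g₂ ^ ρ) ^ ν)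
        (C u * (X 2 - C a' * X 1 ^ ρ) ^ ν) := by
      have h1 := (isInForm_pow _ hzin ν).smul ![x, g₂, g₁] ut
      rw [hut, show ν * (j * r₁) = j * r₁ * ν by ring] at h1
      exact h1
    have hzero := isInForm_sub _ hπin hin
    rw [hΦua, sub_self] at hzero
    have hmem := mem_succ_of_isInForm_zero _ hgenr hw hzero
    rw [← hbridge] at hmem
    exact critical_nonSolvable hdim3 h𝔪 hΦ hν hb hbound hadm hab hq₂ (by rw [hρ, mul_comm]) hj hqj hsum hπP hhE ut at' hmem

end Main

end Iota3

open Iota3 in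
/-- **GAP LIST OF RECORD for `stub_keyRungGrHomLE_three` — the dominance residue replaced by LEMMA C (pure algebra).**
`KeyRungGrHomLE 3 p` from hD (desc-τ as typed; door-proved `Iota3.isTiePosition_descent_door`), hgame, and **LEMMA C**: for every field
`κ` and naturals `0 < r₂ < r₁`, `1 ≤ j`, `1 ≤ ν`: a pure `Φ ∈ κ[X₁, X₂]` (monomials `X₁^{e₁}X₂^{e₂}` with `r₁e₂ + r₂e₁ = r₁ν`) containing
`X₂^ν`, which is also `Σ_{e pure} θ_e η^{e₁} ζ^{e₂}` for `η`, `ζ` weighted homogeneous of degrees `j r₂`, `j r₁` (weights `(r₂, j r₂, j r₁)`)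
with `X₀^j ∈ supp η`, is `u (X₂ − a X₁^{r₁/r₂})^ν` (`a ≠ 0` only if `r₂ ∣ r₁`).
(`keyRungGrHomLE_three_of_residue3` ∘ `Iota3.secondMember_mem_of_lemmaC`.) [OURS · L1 W4.3 · audit glue] -/
theorem keyRungGrHomLE_three_of_lemmaC (p : ℕ)
    (hD : ∀ (T T' : Type) [CommRing T] [IsRegularLocalRing T] [CommRing T'] [IsRegularLocalRing T'] [Algebra T T']
      [IsLocalHom (algebraMap T T')] [Algebra.FormallySmooth T T'] [Algebra.EssFiniteType T T'] (g : T),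
      ringKrullDim T' ≤ 3 → IsTiePosition T' (algebraMap T T' g) → IsTiePosition T g)
    (hgame : CanonicalGameClauseHomLE 3 p iotaFlatT jFlatT)
    (hC : ∀ (κ : Type) [Field κ] (r₁ r₂ j ν : ℕ), 0 < r₂ → r₂ < r₁ → 1 ≤ j → 1 ≤ ν →
      ∀ (Φ η ζ : MvPolynomial (Fin 3) κ) (s : Finset (Fin 3 →₀ ℕ)) (θ : (Fin 3 →₀ ℕ) → κ),
      (∀ e ∈ Φ.support, e 0 = 0 ∧ r₁ * e 2 + r₂ * e 1 = r₁ * ν) →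
      Φ.coeff (Finsupp.single 2 ν) ≠ 0 →
      η.IsWeightedHomogeneous ![r₂, j * r₂, j * r₁] (j * r₂) → η.coeff (Finsupp.single 0 j) ≠ 0 →
      ζ.IsWeightedHomogeneous ![r₂, j * r₂, j * r₁] (j * r₁) →
      (∀ e ∈ s, e 0 = 0 ∧ r₁ * e 2 + r₂ * e 1 = r₁ * ν) →
      Φ = ∑ e ∈ s, C (θ e) * (η ^ (e 1) * ζ ^ (e 2)) →
      ∃ u a : κ, Φ = C u * (X 2 - C a * X 1 ^ (r₁ / r₂)) ^ ν ∧ (a ≠ 0 → r₂ ∣ r₁)) :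
    KeyRungGrHomLE 3 p :=
  keyRungGrHomLE_three_of_residue3 p hD hgame
    (fun A _ _ _ hdim hf0 hfm _ _ _ hb hbound _ _ _ _ _ _ _ hadm hab hq₂ hr hΦ hΦ' hF hF' =>
      secondMember_mem_of_lemmaC hdim hf0 hfm (hC (ResidueField A)) hb hbound hadm hab hq₂ hr hΦ hΦ' hF hF')

end Summit.ResolutionOfSingularities.ResolutionOfSingularities.Cruxes.HypersurfaceCentreConstruction.LocalEngine

end
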